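import Summits.CriticalPhenomena.PercolationContinuityZ3.Theorems.PercNearOneGluingNoHeavyLowerTailQ44FibreBlobJoin

/-!
# Two-copy fibre factorisation: the antipodal fibre count is a product of block tables

Support file for crux `stmt-CriticalPhenomena-4575` (rows `W = 2·Q44`, `U`, `D_U`, `S3` for all `n`), seat `prim-bnk-1` gen 40;
memo `run/shared/lean/prim/prim-l12/FROM-prim-bnk-1-gen40-FIBRE-BRIDGE.md`.  Step (ii) of the LAW-LEVEL FIBRE BRIDGE.

The law-level bridge `TwoCopyMono.sum_kernel_cell_nonneg_of_supported_fibres` reduces a quadratic cell row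
`Σ κᵢⱼ cellᵢ cellⱼ ≥ 0` on a weighted graph to the nonnegativity, for every supported fibre `(M, C)` (free pairs `M`, contracted
pairs `C`), of the antipodal count `Σ_{T ⊆ M} liftK κ (prof (C ∪ T)) (prof (C ∪ (M ∖ T)))`.  THIS FILE evaluates that count:

* `cellOf ω` — the index of the terminal cell of a configuration (`prof ω = pp (cellOf ω)`), so the count is
  `Σ_{T ⊆ M} κ (cellOf (C ∪ T)) (cellOf (C ∪ (M ∖ T)))` (`liftK_prof`); `cellOf_union` — cell of a separated union = `pjoin`.
* `blockTab Mb Cb` — the antipodal pair TABLE of a block: `T(s,t) = #{S ⊆ Mb : cellOf (Cb ∪ S) = s, cellOf (Cb ∪ (Mb ∖ S)) = t}`,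
  with `tact_blockTab`: its action `VCCone.tact` on a kernel is the sum over the splittings of the block.
* **`fibre_factor`** — if the pairs of `M ∪ C` are labelled so that pairs with different labels share only terminal vertices
  (e.g. label = internal component; in the vertex-cover class, label = the internal end point), then the antipodal count equals
  `(tactList [blockTab (M ∩ l) (C ∩ l)]_l κ) (x₀, x₀)`, `x₀ = cellOf ∅` — the gadget factorisation `D_K(H) = (Π_C G_C · K)(⊥,⊥)`
  of the memo, now for LAW-LEVEL fibres.  Proof: peel one block with the blob-join lemma `prof_union_eq_pjoin`
  (`…Q44FibreBlobJoin`) and `sum_powerset_union_of_disjoint`, commute the block action to the front (`tactList_tact`).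
Consumers: the vertex-cover law theorems (`…Q44VertexCoverLaw*`) and the general socket "tt-dominance of every block ⟹ row".
No sorries, no named facts; standard axioms.  Definitions `cellOf`, `blockTab` (noncomputable, via `Classical.choose`).
-/

namespace Summit.CriticalPhenomena.PercolationContinuityZ3.Theorems

namespace VCCone

open TwoCopyMono FourPointAtoms Literature.Probability.Percolation

variable {n : ℕ}


/-! ## The cell of a configuration -/

/-- The index of the terminal cell of the configuration `ω` (its profile is one of the 15 partition profiles). [this work] -/
noncomputable def cellOf (a b c y : Fin n) (ω : Set (Sym2 (Fin n))) : Fin 15 :=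
  Classical.choose (exists_pat_of_isEqv (prof_isEqv a b c y ω))

/-- Defining property of `cellOf`. [this work] -/
theorem prof_eq_pp_cellOf (a b c y : Fin n) (ω : Set (Sym2 (Fin n))) : prof a b c y ω = pp (cellOf a b c y ω) :=
  Classical.choose_spec (exists_pat_of_isEqv (prof_isEqv a b c y ω))

/-- `cellOf` is determined by the profile. [this work] -/
theorem cellOf_eq_of_prof_eq {a b c y : Fin n} {ω : Set (Sym2 (Fin n))} {i : Fin 15} (h : prof a b c y ω = pp i) :
    cellOf a b c y ω = i :=
  pp_injective _ _ ((prof_eq_pp_cellOf a b c y ω).symm.trans h)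

/-- The lifted kernel evaluated at two configurations is the kernel entry at their cells. [this work] -/
theorem liftK_prof (κ : Ker) (a b c y : Fin n) (ω ω' : Set (Sym2 (Fin n))) :
    liftK κ (prof a b c y ω) (prof a b c y ω') = κ (cellOf a b c y ω) (cellOf a b c y ω') := by
  rw [prof_eq_pp_cellOf, prof_eq_pp_cellOf, liftK_pp]

/-- **Blob join, cell form**: the cell of a union of two configurations sharing only terminal vertices is the join of their
cells. [this work] -/
theorem cellOf_union (a b c y : Fin n) (ω B : Set (Sym2 (Fin n)))
    (hsep : ∀ e ∈ ω, ∀ e' ∈ B, ∀ v : Fin n, v ∈ e → v ∈ e' → ∃ k, quad a b c y k = v) :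
    cellOf a b c y (ω ∪ B) = pjoin (cellOf a b c y ω) (cellOf a b c y B) :=
  cellOf_eq_of_prof_eq (prof_union_eq_pjoin a b c y ω B hsep (prof_eq_pp_cellOf a b c y ω) (prof_eq_pp_cellOf a b c y B))

/-! ## The table of a block of a fibre -/

/-- The antipodal pair table of a BLOCK of a two-copy fibre with free pairs `Mb` (present in exactly one copy) and contracted
pairs `Cb` (present in both): `T(s,t) = #{S ⊆ Mb : cell(Cb ∪ S) = s, cell(Cb ∪ (Mb ∖ S)) = t}`. [this work] -/
noncomputable def blockTab (a b c y : Fin n) (Mb Cb : Finset (Sym2 (Fin n))) : Table := fun s t =>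
  (Mb.powerset.filter fun S =>
    (cellOf a b c y ↑(Cb ∪ S), cellOf a b c y ↑(Cb ∪ (Mb \ S))) = (s, t)).card

/-- The action of a block table is the sum over the splittings of its free pairs. [this work] -/
theorem tact_blockTab (a b c y : Fin n) (Mb Cb : Finset (Sym2 (Fin n))) (K : Ker) (x z : Fin 15) :
    tact (blockTab a b c y Mb Cb) K x z =
      ∑ S ∈ Mb.powerset, K (pjoin x (cellOf a b c y ↑(Cb ∪ S))) (pjoin z (cellOf a b c y ↑(Cb ∪ (Mb \ S)))) := by
  classical
  rw [tact_apply_prod]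
  set g : Finset (Sym2 (Fin n)) → Fin 15 × Fin 15 := fun S =>
    (cellOf a b c y ↑(Cb ∪ S), cellOf a b c y ↑(Cb ∪ (Mb \ S))) with hg
  symm
  calc (∑ S ∈ Mb.powerset, K (pjoin x (cellOf a b c y ↑(Cb ∪ S))) (pjoin z (cellOf a b c y ↑(Cb ∪ (Mb \ S)))))
      = ∑ S ∈ Mb.powerset, ∑ p : Fin 15 × Fin 15, (if g S = p then K (pjoin x p.1) (pjoin z p.2) else 0) := by
        refine Finset.sum_congr rfl fun S _ => ?_
        rw [Finset.sum_ite_eq]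
        simp [hg]
    _ = ∑ p : Fin 15 × Fin 15, ∑ S ∈ Mb.powerset, (if g S = p then K (pjoin x p.1) (pjoin z p.2) else 0) :=
        Finset.sum_comm
    _ = ∑ p : Fin 15 × Fin 15, (blockTab a b c y Mb Cb p.1 p.2 : ℤ) * K (pjoin x p.1) (pjoin z p.2) := by
        refine Finset.sum_congr rfl fun p _ => ?_
        rw [← Finset.sum_filter, Finset.sum_const, nsmul_eq_mul]
        unfold blockTab
        rfl

/-- A table acting before a list of tables may be moved to the front (all actions commute). [this work] -/
theorem tactList_tact (G : Table) (K : Ker) : ∀ Gs : List Table, tactList Gs (tact G K) = tact G (tactList Gs K)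
  | [] => rfl
  | H :: Gs => by
    show tact H (tactList Gs (tact G K)) = tact G (tact H (tactList Gs K))
    rw [tactList_tact G K Gs, tact_comm]

/-- Splitting a sum over the subsets of a disjoint union. [folklore] -/
theorem sum_powerset_union_of_disjoint {α M : Type*} [DecidableEq α] [AddCommMonoid M] {A B : Finset α}
    (hAB : Disjoint A B) (F : Finset α → M) :
    ∑ T ∈ (A ∪ B).powerset, F T = ∑ T' ∈ B.powerset, ∑ S ∈ A.powerset, F (S ∪ T') := by
  rw [← Finset.sum_product']
  refine Finset.sum_bij' (fun T _ => (T ∩ B, T ∩ A)) (fun p _ => p.2 ∪ p.1) ?_ ?_ ?_ ?_ ?_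
  · intro T hT
    simp only [Finset.mem_product, Finset.mem_powerset]
    exact ⟨Finset.inter_subset_right, Finset.inter_subset_right⟩
  · intro p hp
    simp only [Finset.mem_product, Finset.mem_powerset] at hp
    rw [Finset.mem_powerset]
    exact Finset.union_subset (hp.2.trans Finset.subset_union_left) (hp.1.trans Finset.subset_union_right)
  · intro T hT
    rw [Finset.mem_powerset] at hT
    ext e
    simp only [Finset.mem_union, Finset.mem_inter]
    constructor
    · rintro (⟨h, _⟩ | ⟨h, _⟩) <;> exact h
    · intro h
      rcases Finset.mem_union.1 (hT h) with hA | hB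
      · exact Or.inl ⟨h, hA⟩
      · exact Or.inr ⟨h, hB⟩
  · intro p hp
    simp only [Finset.mem_product, Finset.mem_powerset] at hp
    obtain ⟨h1, h2⟩ := hp
    ext e <;> simp only [Finset.mem_inter, Finset.mem_union]
    · constructor
      · rintro ⟨h | h, he⟩
        · exact absurd (Finset.mem_inter.2 ⟨h2 h, he⟩) (Finset.disjoint_iff_inter_eq_empty.1 hAB ▸ Finset.notMem_empty e)
        · exact h
      · intro h; exact ⟨Or.inr h, h1 h⟩
    · constructor
      · rintro ⟨h | h, he⟩
        · exact h
        · exact absurd (Finset.mem_inter.2 ⟨he, h1 h⟩) (Finset.disjoint_iff_inter_eq_empty.1 hAB ▸ Finset.notMem_empty e)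
      · intro h; exact ⟨Or.inl h, h2 h⟩
  · intro T hT
    rw [Finset.mem_powerset] at hT
    show F T = F (T ∩ A ∪ T ∩ B)
    rw [← Finset.inter_union_distrib_left, Finset.inter_eq_left.2 hT]

/-! ## The factorisation theorem -/

/-- **Two-copy fibre factorisation.**  Let the pairs of a fibre `(M, C)` (free pairs `M`, contracted pairs `C`) be labelled by
`blk` so that two pairs with different labels share only terminal vertices (`a b c y`), and let `ls` be a duplicate-free list
containing all labels.  Then the antipodal fibre count of every kernel `κ`,
`Σ_{T ⊆ M} κ(cell(C ∪ T), cell(C ∪ (M ∖ T)))`, equals the `(x₀,x₀)` entry of the kernel obtained by letting the block tables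
`blockTab (M ∩ blk⁻¹ l) (C ∩ blk⁻¹ l)`, `l ∈ ls`, act on `κ` (`x₀` = the cell of the empty configuration, `= ⊥` for distinct
terminals). [this work] -/
theorem fibre_factor (a b c y : Fin n) {β : Type*} [DecidableEq β] (blk : Sym2 (Fin n) → β) :
    ∀ (ls : List β) (κ : Ker) (M C : Finset (Sym2 (Fin n))), ls.Nodup → (∀ e ∈ M ∪ C, blk e ∈ ls) →
      (∀ e ∈ M ∪ C, ∀ e' ∈ M ∪ C, blk e ≠ blk e' → ∀ v : Fin n, v ∈ e → v ∈ e' → ∃ k, quad a b c y k = v) →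
      ∑ T ∈ M.powerset, κ (cellOf a b c y ↑(C ∪ T)) (cellOf a b c y ↑(C ∪ (M \ T))) =
        tactList (ls.map fun l => blockTab a b c y (M.filter fun e => blk e = l) (C.filter fun e => blk e = l)) κ
          (cellOf a b c y ↑(∅ : Finset (Sym2 (Fin n)))) (cellOf a b c y ↑(∅ : Finset (Sym2 (Fin n))))
  | [], κ, M, C, _, hls, _ => by
    have hM : M = ∅ := Finset.eq_empty_of_forall_notMem fun e he => by
      simpa using hls e (Finset.mem_union_left _ he)
    have hC : C = ∅ := Finset.eq_empty_of_forall_notMem fun e he => by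
      simpa using hls e (Finset.mem_union_right _ he)
    subst hM; subst hC
    simp only [Finset.powerset_empty, Finset.sum_singleton, Finset.empty_union, sdiff_self, Finset.bot_eq_empty,
      List.map_nil]
    rfl
  | l :: ls, κ, M, C, hnd, hls, hsep => by
    classical
    -- split off the block `l`
    set Ml := M.filter fun e => blk e = l with hMl
    set M' := M.filter fun e => ¬ blk e = l with hM'
    set Cl := C.filter fun e => blk e = l with hCl
    set C' := C.filter fun e => ¬ blk e = l with hC'
    have hMU : Ml ∪ M' = M := Finset.filter_union_filter_not_eq _ _
    have hCU : Cl ∪ C' = C := Finset.filter_union_filter_not_eq _ _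
    have hMd : Disjoint Ml M' := Finset.disjoint_filter_filter_not M M fun e => blk e = l
    -- separation between the block `l` and the rest
    have hsep' : ∀ (T' S : Finset (Sym2 (Fin n))), T' ⊆ M' → S ⊆ Ml →
        ∀ e ∈ (↑(C' ∪ T') : Set (Sym2 (Fin n))), ∀ e' ∈ (↑(Cl ∪ S) : Set (Sym2 (Fin n))), ∀ v : Fin n,
          v ∈ e → v ∈ e' → ∃ k, quad a b c y k = v := by
      intro T' S hT' hS e he e' he' v hv hv'
      rw [Finset.mem_coe, Finset.mem_union] at he he'
      have he1 : e ∈ M ∪ C ∧ blk e ≠ l := by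
        rcases he with he | he
        · rw [hC', Finset.mem_filter] at he; exact ⟨Finset.mem_union_right _ he.1, he.2⟩
        · have := hT' he; rw [hM', Finset.mem_filter] at this; exact ⟨Finset.mem_union_left _ this.1, this.2⟩
      have he2 : e' ∈ M ∪ C ∧ blk e' = l := by
        rcases he' with he' | he'
        · rw [hCl, Finset.mem_filter] at he'; exact ⟨Finset.mem_union_right _ he'.1, he'.2⟩
        · have := hS he'; rw [hMl, Finset.mem_filter] at this; exact ⟨Finset.mem_union_left _ this.1, this.2⟩
      exact hsep e he1.1 e' he2.1 (by rw [he2.2]; exact he1.2) v hv hv'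
    -- the summand on `T = S ∪ T'`
    have hterm : ∀ T' ∈ M'.powerset, ∀ S ∈ Ml.powerset,
        κ (cellOf a b c y ↑(C ∪ (S ∪ T'))) (cellOf a b c y ↑(C ∪ (M \ (S ∪ T')))) =
          κ (pjoin (cellOf a b c y ↑(C' ∪ T')) (cellOf a b c y ↑(Cl ∪ S)))
            (pjoin (cellOf a b c y ↑(C' ∪ (M' \ T'))) (cellOf a b c y ↑(Cl ∪ (Ml \ S)))) := by
      intro T' hT' S hS
      rw [Finset.mem_powerset] at hT' hS
      have e1 : (↑(C ∪ (S ∪ T')) : Set (Sym2 (Fin n))) = ↑(C' ∪ T') ∪ ↑(Cl ∪ S) := by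
        rw [← Finset.coe_union]; congr 1
        ext e; simp only [Finset.mem_union]
        rw [← hCU, Finset.mem_union]; tauto
      have e2 : (↑(C ∪ (M \ (S ∪ T'))) : Set (Sym2 (Fin n))) = ↑(C' ∪ (M' \ T')) ∪ ↑(Cl ∪ (Ml \ S)) := by
        rw [← Finset.coe_union]; congr 1
        ext e; simp only [Finset.mem_union, Finset.mem_sdiff]
        rw [← hCU, Finset.mem_union, ← hMU, Finset.mem_union]
        constructor
        · rintro ((h | h) | ⟨h1 | h1, h2⟩)
          · exact Or.inr (Or.inl h)
          · exact Or.inl (Or.inl h)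
          · exact Or.inr (Or.inr ⟨h1, fun h => h2 (Or.inl h)⟩)
          · exact Or.inl (Or.inr ⟨h1, fun h => h2 (Or.inr h)⟩)
        · rintro ((h | ⟨h1, h2⟩) | (h | ⟨h1, h2⟩))
          · exact Or.inl (Or.inr h)
          · refine Or.inr ⟨Or.inr h1, ?_⟩
            rintro (h | h)
            · exact (Finset.disjoint_left.1 hMd (hS h)) h1
            · exact h2 h
          · exact Or.inl (Or.inl h)
          · refine Or.inr ⟨Or.inl h1, ?_⟩
            rintro (h | h)
            · exact h2 h
            · exact (Finset.disjoint_left.1 hMd h1) (hT' h)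
      rw [e1, e2, cellOf_union a b c y _ _ (hsep' T' S hT' hS),
        cellOf_union a b c y _ _ (hsep' (M' \ T') (Ml \ S) Finset.sdiff_subset Finset.sdiff_subset)]
    -- rewrite the fibre sum as an iterated sum and recognise the block table
    rw [← hMU, sum_powerset_union_of_disjoint hMd]
    rw [hMU]
    have hstep : ∀ T' ∈ M'.powerset,
        (∑ S ∈ Ml.powerset, κ (cellOf a b c y ↑(C ∪ (S ∪ T'))) (cellOf a b c y ↑(C ∪ (M \ (S ∪ T'))))) =
          tact (blockTab a b c y Ml Cl) κ (cellOf a b c y ↑(C' ∪ T')) (cellOf a b c y ↑(C' ∪ (M' \ T'))) := by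
      intro T' hT'
      rw [tact_blockTab]
      exact Finset.sum_congr rfl fun S hS => hterm T' hT' S hS
    rw [Finset.sum_congr rfl hstep]
    -- induction hypothesis for the remaining fibre `(M', C')` and the kernel `tact (blockTab Ml Cl) κ`
    have hnd' : ls.Nodup := (List.nodup_cons.1 hnd).2
    have hl : l ∉ ls := (List.nodup_cons.1 hnd).1
    have hls' : ∀ e ∈ M' ∪ C', blk e ∈ ls := by
      intro e he
      have h1 : e ∈ M ∪ C ∧ blk e ≠ l := by
        rcases Finset.mem_union.1 he with he | he
        · rw [hM', Finset.mem_filter] at he; exact ⟨Finset.mem_union_left _ he.1, he.2⟩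
        · rw [hC', Finset.mem_filter] at he; exact ⟨Finset.mem_union_right _ he.1, he.2⟩
      rcases List.mem_cons.1 (hls e h1.1) with h | h
      · exact absurd h h1.2
      · exact h
    have hsub : M' ∪ C' ⊆ M ∪ C := by
      rw [← hMU, ← hCU]
      intro e he
      rcases Finset.mem_union.1 he with he | he
      · exact Finset.mem_union_left _ (Finset.mem_union_right _ he)
      · exact Finset.mem_union_right _ (Finset.mem_union_right _ he)
    have hsep2 : ∀ e ∈ M' ∪ C', ∀ e' ∈ M' ∪ C', blk e ≠ blk e' → ∀ v : Fin n, v ∈ e → v ∈ e' →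
        ∃ k, quad a b c y k = v := fun e he e' he' => hsep e (hsub he) e' (hsub he')
    rw [fibre_factor a b c y blk ls (tact (blockTab a b c y Ml Cl) κ) M' C' hnd' hls' hsep2]
    -- the block tables of the remaining labels are unchanged
    have htabs : (ls.map fun l' => blockTab a b c y (M'.filter fun e => blk e = l') (C'.filter fun e => blk e = l')) =
        ls.map fun l' => blockTab a b c y (M.filter fun e => blk e = l') (C.filter fun e => blk e = l') := by
      refine List.map_congr_left fun l' hl' => ?_
      have hne : l' ≠ l := fun h => hl (h ▸ hl')
      rw [hM', hC', Finset.filter_filter, Finset.filter_filter]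
      congr 1
      · refine Finset.filter_congr fun e _ => ?_
        exact ⟨fun h => h.2, fun h => ⟨by rw [h]; exact hne, h⟩⟩
      · refine Finset.filter_congr fun e _ => ?_
        exact ⟨fun h => h.2, fun h => ⟨by rw [h]; exact hne, h⟩⟩
    rw [htabs, tactList_tact]
    rfl

end VCCone

end Summit.CriticalPhenomena.PercolationContinuityZ3.Theorems
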